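import Literature.IUT.HodgeArakelov.LabelClassesOfCuspsCor24iOfSpecialFibre
import Literature.IUT.HodgeArakelov.StableCurveAgreementOfSpecialFibre
import Literature.IUT.HodgeArakelov.PlusMinusTowerPiVIndex
import HarnessLib

/-!
# [IUTchII] Cor 2.4 (i)′ AT THE GENUINE PAIR: the tower of record `ofPiCHat` ↔ the [IUTchI] §2 datum `ofSpecialFibre` of `X̲_v`

S. Mochizuki, *Inter-universal Teichmüller Theory II*, kurims manuscript (Dec. 2020), §2: Def 2.3 (i)(ii) pp. 67–68, Cor 2.4 (i) pp. 69–71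
(proof p. 70 l. −5 – p. 71 l. 5), Rmk 2.4.1 p. 71; *Inter-universal Teichmüller Theory I* (May 2020), §2: Cor 2.3 (ii)/(v) pp. 47–48,
Prop 2.4 (i) p. 50, Cor 2.5 p. 51, Def 3.1 (e) p. 62 [cite: Mochizuki2012, II Cor 2.4 (i) pp.69–71; I §2 pp.46–51] (D-0012 claim key, status
DISPUTED: every [IUTchI]/[IUTchII] statement below is a HYPOTHESIS named by the tree's typed predicates or a kernel theorem about the tree's own
constructions; nothing printed is asserted); [SemiAnbd] §6 pp. 69–71 [cite: MochizukiSemiAnbd2006, §6 p.69].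

abc-iut cell, node **IUTchII:Cor2.4(i)** (CONE-BOARD claimant abc-iut-w4-d012; gen 6), GAP-LEDGER **G-w4d012-1** («what remains to instantiate is
the agreement itself at the common model + hΛ», D-row 2026-08-26T00:33:22Z) — part 2 of 2 (part 1: `LabelClassesOfCuspsCor24iOfSpecialFibre.lean`,
the closers at ANY agreement with a special-fibre datum).  PROOF-ONLY (no `def`/`instance`/`structure`).  Consumed BY NAME: abc-iut-w5-d132's
B15 pieces `exists_embHat_ofPiCHat`, `continuous_aug_pmHat_ofPiCHat` (p431233), `ofCoverModel_aug_ι_inclX` (p430433) and the proof of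
`exists_stableCurveAgreement_ofPiCHat_ofSpecialFibre` (p433029, re-run through part 1's `exists_of_isProfiniteCompletion_isHomeomorph`);
abc-iut-L6-t19's B14 tower `PlusMinusTower.ofPiCHat` (p430122) and `index_piV_subgroupOf_piPM_ofUnderline`; abc-iut-L6-t7's
`TemperedCurve.ofOpenSubgroup` (B15 piece 1, p432410); abc-iut-L5-t11's `StableCurveTemperedData.ofSpecialFibre`.

* `index_piV_subgroupOf_piPM_ofUnderline_ne_zero` — `[Π^±_v : Π_v] = l ≠ 0` for every tower over the print-level model;
* `exists_stableCurveAgreement_ofPiCHat_ofSpecialFibre_isHomeomorph` — B15 piece 3 WITH BICONTINUITY: the agreement between the GENUINE tower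
  `ofPiCHat` and the GENUINE datum `ofSpecialFibre` of `X̲_v := TemperedCurve.ofOpenSubgroup … (GtpXu l) …` comes with `IsHomeomorph A.eHat`,
  `eHat ∘ emb = ιX ∘ plainIso` and the level clause of the transported cuspidal datum;
* **`cor24_i'_ofPiCHat_ofSpecialFibre`** — the decl of record `Cor24_i' Dec (ofPiCHat …) Cu Ld I` HOLDS at the genuine tower for every
  `Π_v`-cuspidal `I ⊆ Δ̂^cor_v`, with the agreement, its bicontinuity, `[Π^±_v : Π_v] = l`, the Rmk 2.4.1 datum `hΛ`, input (A) modulo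
  [IUTchI] Prop 2.4 (i), and [IUTchI] Cor 2.3 (ii) ALL DISCHARGED (part 1), modulo the NAMED residual {[IUTchI] Prop 2.4 (i) of `X̲_v`'s datum
  (L5 node IUTchI:Prop2.4(i)); per admissible `Π_{v□}` a sub-graph `Π^tp_{ℍ'}` of the special fibre of `X̲_v` with `Π̂_{ℍ'}` its closure,
  the Δ-dictionary identity through `A.eHat` and [IUTchI] Cor 2.3 (v) of its datum (L5 node IUTchI:Cor2.3(v)); the open-subgroup step (B)
  `h23vi` (GAP-LEDGER G-w4d012-2, by-name reductions p419450/p420168/p420922)}.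

HONEST LABEL: GENUINE on both sides modulo the binders in the signatures (L02 `hZ`, `hN`, `hDopen`, the special-fibre DATA of `X̲_v`, which
nobody constructs: the dual semi-graph of the special fibre of the [EtTh] model stays quantified).  G-w4d012-1's named leftovers are closed in
the kernel.  Typed ≠ proved for Prop 2.4 (i) / Cor 2.3 (v) themselves; nothing here takes a side on [IUTchIII] Cor 3.12 or asserts anything
of the series.
-/

noncomputable section

namespace Literature.IUT.HodgeArakelov

open Literature.AnabelianGeometry.EtaleTheta Literature.AnabelianGeometry.SemiGraphs Literature.IUT.HodgeTheaters
open scoped Pointwise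

namespace PlusMinusTower

variable {p : ℕ} [Fact p.Prime] {M : MuTwoSetting p} (e : M.CLevelData)
  {E : M.toThetaSetting.EtaleThetaData} {l : ℕ} (C : E.DoubleUnderline l) {N : ℕ+}
  (μ : M.toThetaSetting.CyclotomeMod l N) (hC : M.toThetaSetting.Compat) (hS : M.toThetaSetting.Sec2Hyps)
  (hl : l.Prime) (hp2 : p ≠ 2) (hpl : p ≠ l) (hζ : ∃ ζ : M.toThetaSetting.K, IsPrimitiveRoot ζ (4 * l))
  {η : (C.thetaEnvData μ hC hS).PiYdd → MuN p N} (hη : η ∈ (C.thetaEnvData μ hC hS).thetaCocycles)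
  (hZ : Thm16Sub.KerToZIsCompactlyGenerated M.toThetaSetting) (hN : (C.Huu.subgroupOf (M.GtpXu l)).Normal)
  {P : TopGroup.{0}} (T : TemperedCoverings (BadPlaceSetting.ofUnderline C μ hC hS hl hp2 hpl hζ hη) P)

include C in
/-- `[Π^±_v : Π_v] = l ≠ 0` for every tower over the print-level model (abc-iut-L6-t19 `index_piV_subgroupOf_piPM_ofUnderline`).
([IUTchII] Def 2.3 (i), kurims p.67) [claim: Mochizuki2012, status: disputed] -/
theorem index_piV_subgroupOf_piPM_ofUnderline_ne_zero (W : PlusMinusTower T) : (W.piV.subgroupOf W.piPM).index ≠ 0 := by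
  rw [W.index_piV_subgroupOf_piPM_ofUnderline C μ hC hS hl hp2 hpl hζ hη]
  exact C.l_ne_zero

/-- **B15 PIECE 3 WITH BICONTINUITY — [IUTchII] Def 2.3 (i) «`Π̂^±_v := Π̂_{X̲_v}`» at the genuine pair**: abc-iut-w5-d132's
`exists_stableCurveAgreement_ofPiCHat_ofSpecialFibre` (p433029) re-derived through part 1's `exists_of_isProfiniteCompletion_isHomeomorph`, so that
the agreement between abc-iut-L6-t19's GENUINE tower `ofPiCHat` and abc-iut-L5's GENUINE datum `ofSpecialFibre` of the curve
`X̲_v = TemperedCurve.ofOpenSubgroup … (GtpXu l) …` (abc-iut-L6-t7, B15 piece 1) comes with `IsHomeomorph A.eHat`, `eHat ∘ emb = ιX ∘ plainIso`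
and the level clause of the transported cuspidal datum.  Same binders as p433029 (`hDopen`, the special-fibre DATA of `X̲_v`).  PROVED.
([IUTchII] Def 2.3 (i)(ii), kurims pp.67–68) [claim: Mochizuki2012, status: disputed] -/
theorem exists_stableCurveAgreement_ofPiCHat_ofSpecialFibre_isHomeomorph [(M.GtpXu l).FiniteIndex] [FiniteDimensional ℚ_[p] M.K]
    (hDopen : ∀ (x : M.toTemperedCurve.Pt) (g : M.toTemperedCurve.PiTemp),
      IsOpen (M.toTemperedCurve.aug '' ((M.toTemperedCurve.decompOfOpenAt (M.GtpXu l) x g).map (M.GtpXu l).subtype :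
        Set M.toTemperedCurve.PiTemp)))
    (d : (M.toTemperedCurve.ofOpenSubgroup (M.GtpXu l) (M.toThetaSetting.isOpen_GtpXu l) M.K (range_aug_GtpXu_eq_GK C) hDopen).GroupLevelData)
    (Sf : SpecialFibreData ((M.toTemperedCurve.ofOpenSubgroup (M.GtpXu l) (M.toThetaSetting.isOpen_GtpXu l) M.K (range_aug_GtpXu_eq_GK C) hDopen).toTemperedArithmeticGroup d))
    (h36 : Sf.Gc.Prop36Hypotheses) (Sigma SigmaHat : Set ℕ) (hsub : Sigma ⊆ SigmaHat) (hne : Sigma.Nonempty)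
    (hprime : ∀ q ∈ SigmaHat, q.Prime) (hp : p ∉ Sigma) (TpH : Subgroup Sf.chart.G)
    (HatH : Subgroup (TemperedGraphGroupData.exists_completion_of_prop36 Sf.Gc h36 Sf.chart).choose)
    (hle : TpH.map (TemperedGraphGroupData.exists_completion_of_prop36 Sf.Gc h36 Sf.chart).choose_spec.choose.toMonoidHom ≤ HatH)
    (cuspMeetsH : {x : (M.toTemperedCurve.ofOpenSubgroup (M.GtpXu l) (M.toThetaSetting.isOpen_GtpXu l) M.K (range_aug_GtpXu_eq_GK C) hDopen).Pt // (M.toTemperedCurve.ofOpenSubgroup (M.GtpXu l) (M.toThetaSetting.isOpen_GtpXu l) M.K (range_aug_GtpXu_eq_GK C) hDopen).IsCusp x} → Prop) :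
    ∃ (Cu : CuspidalInertiaData (ofPiCHat e C μ hC hS hl hp2 hpl hζ hη hZ hN T))
      (A : StableCurveAgreement (ofPiCHat e C μ hC hS hl hp2 hpl hζ hη hZ hN T) Cu
        (StableCurveTemperedData.ofSpecialFibre (M.toTemperedCurve.ofOpenSubgroup (M.GtpXu l) (M.toThetaSetting.isOpen_GtpXu l) M.K (range_aug_GtpXu_eq_GK C) hDopen) d Sf h36 Sigma SigmaHat hsub hne hprime hp TpH HatH hle cuspMeetsH)),
      IsHomeomorph A.eHat ∧
      (∀ x : T.Xplain,
        A.eHat ⟨(ofPiCHat e C μ hC hS hl hp2 hpl hζ hη hZ hN T).emb x, (ofPiCHat e C μ hC hS hl hp2 hpl hζ hη hZ hN T).emb_le_pmHat ⟨x, rfl⟩⟩ =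
          (StableCurveTemperedData.ofSpecialFibre (M.toTemperedCurve.ofOpenSubgroup (M.GtpXu l) (M.toThetaSetting.isOpen_GtpXu l) M.K (range_aug_GtpXu_eq_GK C) hDopen) d Sf h36 Sigma SigmaHat hsub hne hprime hp TpH HatH hle cuspMeetsH).ιX (T.plainIso x)) ∧
      (∀ (Q I : Subgroup (ofPiCHat e C μ hC hS hl hp2 hpl hζ hη hZ hN T).Corhat), Cu.IsCuspidalInertia Q I ↔
        I ≤ Q ∧ ∃ I₀, Cu.IsCuspidalInertia (ofPiCHat e C μ hC hS hl hp2 hpl hζ hη hZ hN T).piPM I₀ ∧ I = I₀ ⊓ Q) := by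
  -- (a) tower side: `Π̂^±_v` is a profinite completion of `Π^±_v` through `emb` (p431233)
  obtain ⟨embHat, hembHat, hWc⟩ := exists_embHat_ofPiCHat e C μ hC hS hl hp2 hpl hζ hη hZ hN T
  -- (d) `prHat` of the curve side is continuous (`augHat` is)
  have hpr : Continuous (StableCurveTemperedData.OfSpecialFibre.augHatGK (M.toTemperedCurve.ofOpenSubgroup (M.GtpXu l) (M.toThetaSetting.isOpen_GtpXu l) M.K (range_aug_GtpXu_eq_GK C) hDopen)) :=
    (M.toTemperedCurve.ofOpenSubgroup (M.GtpXu l) (M.toThetaSetting.isOpen_GtpXu l) M.K (range_aug_GtpXu_eq_GK C) hDopen).augHat.continuous.subtype_mk _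
  -- (d) `augGK (plainIso x) = aug (emb x)` in `G_K` (σ := id)
  have hcompat : ∀ x : T.Xplain,
      (StableCurveTemperedData.ofSpecialFibre (M.toTemperedCurve.ofOpenSubgroup (M.GtpXu l) (M.toThetaSetting.isOpen_GtpXu l) M.K (range_aug_GtpXu_eq_GK C) hDopen) d Sf h36 Sigma SigmaHat hsub hne hprime hp TpH HatH hle cuspMeetsH).prTp (T.plainIso x) =
        (MonoidHom.id _) ((ofPiCHat e C μ hC hS hl hp2 hpl hζ hη hZ hN T).aug ((ofPiCHat e C μ hC hS hl hp2 hpl hζ hη hZ hN T).emb x)) := by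
    intro x
    apply Subtype.ext
    change M.aug (T.plainIso x).1 = ((ofPiCHat e C μ hC hS hl hp2 hpl hζ hη hZ hN T).aug ((ofPiCHat e C μ hC hS hl hp2 hpl hζ hη hZ hN T).emb x)).1
    exact (ofCoverModel_aug_ι_inclX e C μ hC hS hl hp2 hpl hζ hη e.toPiCHat e.isProfiniteCompletion_toPiCHat e.toPiCHat_injective
      e.piCData.aug.toMonoidHom (fun g => e.piCData_aug_apply g) e.piCData.range_aug hZ hN T (T.plainIso x).1).symm
  obtain ⟨Cu, A, hhomeo, hA, hlev⟩ := StableCurveAgreement.exists_of_isProfiniteCompletion_isHomeomorph (ofPiCHat e C μ hC hS hl hp2 hpl hζ hη hZ hN T)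
    (StableCurveTemperedData.ofSpecialFibre (M.toTemperedCurve.ofOpenSubgroup (M.GtpXu l) (M.toThetaSetting.isOpen_GtpXu l) M.K (range_aug_GtpXu_eq_GK C) hDopen) d Sf h36 Sigma SigmaHat hsub hne hprime hp TpH HatH hle cuspMeetsH)
    embHat hembHat hWc (M.toTemperedCurve.ofOpenSubgroup (M.GtpXu l) (M.toThetaSetting.isOpen_GtpXu l) M.K (range_aug_GtpXu_eq_GK C) hDopen).toHat (fun _ => rfl) (M.toTemperedCurve.ofOpenSubgroup (M.GtpXu l) (M.toThetaSetting.isOpen_GtpXu l) M.K (range_aug_GtpXu_eq_GK C) hDopen).isProfiniteCompletion_toHat T.plainIso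
    (continuous_aug_pmHat_ofPiCHat e C μ hC hS hl hp2 hpl hζ hη hZ hN T) hpr (MonoidHom.id _) continuous_id Function.injective_id hcompat
  refine ⟨Cu, A, hhomeo, fun x => ?_, hlev⟩
  have h2 : embHat x = ⟨(ofPiCHat e C μ hC hS hl hp2 hpl hζ hη hZ hN T).emb x, (ofPiCHat e C μ hC hS hl hp2 hpl hζ hη hZ hN T).emb_le_pmHat ⟨x, rfl⟩⟩ :=
    Subtype.ext (hembHat x)
  have h1 := hA x
  rw [h2] at h1
  exact h1

/-- **[IUTchII] Cor 2.4 (i)′ AT THE GENUINE PAIR** (kurims pp. 69–71): at abc-iut-L6-t19's tower of record `ofPiCHat` and abc-iut-L5's datum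
`ofSpecialFibre` of the curve `X̲_v` (B15), for ANY special-fibre data of `X̲_v` (`d, Sf, h36, Σ ⊆ Σ̂`) and ANY sub-graph parameter of the MAIN
datum (`TpH, HatH, hle, cuspMeetsH` — e.g. `Γ^▶_X`), there are the transported cuspidal datum `Cu` and a BICONTINUOUS agreement `A`
(`eHat ∘ emb = ιX ∘ plainIso`, level clause) such that the decl of record `Cor24_i' Dec (ofPiCHat …) Cu Ld I` HOLDS for every `Π_v`-cuspidal
`I ⊆ Δ̂^cor_v` MODULO THE NAMED RESIDUAL: [IUTchI] Prop 2.4 (i) of `X̲_v`'s datum (`Prop24i`, L5 node); per admissible `Π_{v□}` (`Cor24_family`)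
a sub-graph `Π^tp_{ℍ'}` with `Π̂_{ℍ'}` its closure, the Δ-dictionary identity through `A.eHat` and [IUTchI] Cor 2.3 (v) of its datum; the
open-subgroup step (B) (`h23vi`, GAP-LEDGER G-w4d012-2).  DISCHARGED here (G-w4d012-1's leftovers): the agreement itself, its bicontinuity,
`[Π^±_v : Π_v] = l`, the Rmk 2.4.1 datum `hΛ`, input (A) modulo `Prop24i`, and Cor 2.3 (ii).  HONEST LABEL: genuine on both sides modulo the
binders `hZ`, `hN`, `hDopen` and the special-fibre DATA of `X̲_v`.  PROVED (part 1's `cor24_i'_ofSpecialFibre`).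
([IUTchII] Cor 2.4 (i), kurims pp.69–71) [claim: Mochizuki2012, status: disputed] -/
theorem cor24_i'_ofPiCHat_ofSpecialFibre [(M.GtpXu l).FiniteIndex] [FiniteDimensional ℚ_[p] M.K]
    (hDopen : ∀ (x : M.toTemperedCurve.Pt) (g : M.toTemperedCurve.PiTemp),
      IsOpen (M.toTemperedCurve.aug '' ((M.toTemperedCurve.decompOfOpenAt (M.GtpXu l) x g).map (M.GtpXu l).subtype :
        Set M.toTemperedCurve.PiTemp)))
    (d : (M.toTemperedCurve.ofOpenSubgroup (M.GtpXu l) (M.toThetaSetting.isOpen_GtpXu l) M.K (range_aug_GtpXu_eq_GK C) hDopen).GroupLevelData)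
    (Sf : SpecialFibreData ((M.toTemperedCurve.ofOpenSubgroup (M.GtpXu l) (M.toThetaSetting.isOpen_GtpXu l) M.K (range_aug_GtpXu_eq_GK C) hDopen).toTemperedArithmeticGroup d))
    (h36 : Sf.Gc.Prop36Hypotheses) (Sigma SigmaHat : Set ℕ) (hsub : Sigma ⊆ SigmaHat) (hne : Sigma.Nonempty)
    (hprime : ∀ q ∈ SigmaHat, q.Prime) (hp : p ∉ Sigma) (TpH : Subgroup Sf.chart.G)
    (HatH : Subgroup (TemperedGraphGroupData.exists_completion_of_prop36 Sf.Gc h36 Sf.chart).choose)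
    (hle : TpH.map (TemperedGraphGroupData.exists_completion_of_prop36 Sf.Gc h36 Sf.chart).choose_spec.choose.toMonoidHom ≤ HatH)
    (cuspMeetsH : {x : (M.toTemperedCurve.ofOpenSubgroup (M.GtpXu l) (M.toThetaSetting.isOpen_GtpXu l) M.K (range_aug_GtpXu_eq_GK C) hDopen).Pt // (M.toTemperedCurve.ofOpenSubgroup (M.GtpXu l) (M.toThetaSetting.isOpen_GtpXu l) M.K (range_aug_GtpXu_eq_GK C) hDopen).IsCusp x} → Prop)
    {D : EtaleThetaData (BadPlaceSetting.ofUnderline C μ hC hS hl hp2 hpl hζ hη).toThetaSetting P}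
    (Dec : SubgraphDecomposition (BadPlaceSetting.ofUnderline C μ hC hS hl hp2 hpl hζ hη) T D) :
    ∃ (Cu : CuspidalInertiaData (ofPiCHat e C μ hC hS hl hp2 hpl hζ hη hZ hN T))
      (A : StableCurveAgreement (ofPiCHat e C μ hC hS hl hp2 hpl hζ hη hZ hN T) Cu
        (StableCurveTemperedData.ofSpecialFibre (M.toTemperedCurve.ofOpenSubgroup (M.GtpXu l) (M.toThetaSetting.isOpen_GtpXu l) M.K (range_aug_GtpXu_eq_GK C) hDopen) d Sf h36 Sigma SigmaHat hsub hne hprime hp TpH HatH hle cuspMeetsH)),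
      IsHomeomorph A.eHat ∧
      (∀ x : T.Xplain,
        A.eHat ⟨(ofPiCHat e C μ hC hS hl hp2 hpl hζ hη hZ hN T).emb x, (ofPiCHat e C μ hC hS hl hp2 hpl hζ hη hZ hN T).emb_le_pmHat ⟨x, rfl⟩⟩ =
          (StableCurveTemperedData.ofSpecialFibre (M.toTemperedCurve.ofOpenSubgroup (M.GtpXu l) (M.toThetaSetting.isOpen_GtpXu l) M.K (range_aug_GtpXu_eq_GK C) hDopen) d Sf h36 Sigma SigmaHat hsub hne hprime hp TpH HatH hle cuspMeetsH).ιX (T.plainIso x)) ∧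
      (∀ (Q I : Subgroup (ofPiCHat e C μ hC hS hl hp2 hpl hζ hη hZ hN T).Corhat), Cu.IsCuspidalInertia Q I ↔
        I ≤ Q ∧ ∃ I₀, Cu.IsCuspidalInertia (ofPiCHat e C μ hC hS hl hp2 hpl hζ hη hZ hN T).piPM I₀ ∧ I = I₀ ⊓ Q) ∧
      ∀ {L : LabCuspStructure Cu} (Ld : LabelledDecomposition Dec L),
        (StableCurveTemperedData.ofSpecialFibre (M.toTemperedCurve.ofOpenSubgroup (M.GtpXu l) (M.toThetaSetting.isOpen_GtpXu l) M.K (range_aug_GtpXu_eq_GK C) hDopen) d Sf h36 Sigma SigmaHat hsub hne hprime hp TpH HatH hle cuspMeetsH).Prop24i →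
        ∀ {I : Subgroup (ofPiCHat e C μ hC hS hl hp2 hpl hζ hη hZ hN T).Corhat},
          Cu.IsCuspidalInertia (ofPiCHat e C μ hC hS hl hp2 hpl hζ hη hZ hN T).piV I → I ≤ (ofPiCHat e C μ hC hS hl hp2 hpl hζ hη hZ hN T).aug.ker →
          (∀ H : Subgroup P, Cor24_family Dec Ld H →
            ∃ (TpH' : Subgroup Sf.chart.G) (HatH' : Subgroup (TemperedGraphGroupData.exists_completion_of_prop36 Sf.Gc h36 Sf.chart).choose)
              (hle' : TpH'.map (TemperedGraphGroupData.exists_completion_of_prop36 Sf.Gc h36 Sf.chart).choose_spec.choose.toMonoidHom ≤ HatH')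
              (cMH' : {x : (M.toTemperedCurve.ofOpenSubgroup (M.GtpXu l) (M.toThetaSetting.isOpen_GtpXu l) M.K (range_aug_GtpXu_eq_GK C) hDopen).Pt // (M.toTemperedCurve.ofOpenSubgroup (M.GtpXu l) (M.toThetaSetting.isOpen_GtpXu l) M.K (range_aug_GtpXu_eq_GK C) hDopen).IsCusp x} → Prop),
              (((StableCurveTemperedData.ofSpecialFibre (M.toTemperedCurve.ofOpenSubgroup (M.GtpXu l) (M.toThetaSetting.isOpen_GtpXu l) M.K (range_aug_GtpXu_eq_GK C) hDopen) d Sf h36 Sigma SigmaHat hsub hne hprime hp TpH' HatH' hle' cMH').graph.HatH :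
                  Set (StableCurveTemperedData.ofSpecialFibre (M.toTemperedCurve.ofOpenSubgroup (M.GtpXu l) (M.toThetaSetting.isOpen_GtpXu l) M.K (range_aug_GtpXu_eq_GK C) hDopen) d Sf h36 Sigma SigmaHat hsub hne hprime hp TpH' HatH' hle' cMH').graph.Hat) =
                closure ((StableCurveTemperedData.ofSpecialFibre (M.toTemperedCurve.ofOpenSubgroup (M.GtpXu l) (M.toThetaSetting.isOpen_GtpXu l) M.K (range_aug_GtpXu_eq_GK C) hDopen) d Sf h36 Sigma SigmaHat hsub hne hprime hp TpH' HatH' hle' cMH').graph.ι ''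
                  (StableCurveTemperedData.ofSpecialFibre (M.toTemperedCurve.ofOpenSubgroup (M.GtpXu l) (M.toThetaSetting.isOpen_GtpXu l) M.K (range_aug_GtpXu_eq_GK C) hDopen) d Sf h36 Sigma SigmaHat hsub hne hprime hp TpH' HatH' hle' cMH').graph.TpH)) ∧
              (((ofPiCHat e C μ hC hS hl hp2 hpl hζ hη hZ hN T).deltaPmBox H).subgroupOf (ofPiCHat e C μ hC hS hl hp2 hpl hζ hη hZ hN T).pmHat).map A.eHat.toMonoidHom =
                ((StableCurveTemperedData.ofSpecialFibre (M.toTemperedCurve.ofOpenSubgroup (M.GtpXu l) (M.toThetaSetting.isOpen_GtpXu l) M.K (range_aug_GtpXu_eq_GK C) hDopen) d Sf h36 Sigma SigmaHat hsub hne hprime hp TpH' HatH' hle' cMH').deltaTpH.map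
                  (StableCurveTemperedData.ofSpecialFibre (M.toTemperedCurve.ofOpenSubgroup (M.GtpXu l) (M.toThetaSetting.isOpen_GtpXu l) M.K (range_aug_GtpXu_eq_GK C) hDopen) d Sf h36 Sigma SigmaHat hsub hne hprime hp TpH' HatH' hle' cMH').ιΔ).map
                  (StableCurveTemperedData.ofSpecialFibre (M.toTemperedCurve.ofOpenSubgroup (M.GtpXu l) (M.toThetaSetting.isOpen_GtpXu l) M.K (range_aug_GtpXu_eq_GK C) hDopen) d Sf h36 Sigma SigmaHat hsub hne hprime hp TpH' HatH' hle' cMH').DeltaHat.subtype ∧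
              (StableCurveTemperedData.ofSpecialFibre (M.toTemperedCurve.ofOpenSubgroup (M.GtpXu l) (M.toThetaSetting.isOpen_GtpXu l) M.K (range_aug_GtpXu_eq_GK C) hDopen) d Sf h36 Sigma SigmaHat hsub hne hprime hp TpH' HatH' hle' cMH').Cor23v) →
          (∀ H : Subgroup P, Cor24_family Dec Ld H → ∀ γ' : (ofPiCHat e C μ hC hS hl hp2 hpl hζ hη hZ hN T).Corhat,
              γ' ∈ (ofPiCHat e C μ hC hS hl hp2 hpl hζ hη hZ hN T).piPM ⊓ (ofPiCHat e C μ hC hS hl hp2 hpl hζ hη hZ hN T).aug.ker →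
              I.map (MulAut.conj γ').toMonoidHom ≤ (ofPiCHat e C μ hC hS hl hp2 hpl hζ hη hZ hN T).pmBox H →
              γ' ∈ closure ((ofPiCHat e C μ hC hS hl hp2 hpl hζ hη hZ hN T).deltaPmBox H : Set (ofPiCHat e C μ hC hS hl hp2 hpl hζ hη hZ hN T).Corhat)) →
          Literature.IUT.HodgeArakelov.Cor24_i' Dec (ofPiCHat e C μ hC hS hl hp2 hpl hζ hη hZ hN T) Cu Ld I := by
  obtain ⟨Cu, A, hhomeo, hA, hlev⟩ := exists_stableCurveAgreement_ofPiCHat_ofSpecialFibre_isHomeomorph e C μ hC hS hl hp2 hpl hζ hη hZ hN T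
    hDopen d Sf h36 Sigma SigmaHat hsub hne hprime hp TpH HatH hle cuspMeetsH
  exact ⟨Cu, A, hhomeo, hA, hlev, fun Ld h24i I hI hIker Dic h23vi =>
    cor24_i'_ofSpecialFibre Dec (ofPiCHat e C μ hC hS hl hp2 hpl hζ hη hZ hN T) Cu Ld (index_piV_subgroupOf_piPM_ofUnderline_ne_zero C μ hC hS hl hp2 hpl hζ hη T _)
      hlev A hhomeo h24i hI hIker Dic h23vi⟩

end PlusMinusTower

end Literature.IUT.HodgeArakelov

end
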